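import Summits.QuantumFields.YangMills.Theorems.UnitScaleTiltProp7BlockPoincareTopMeanKept
import Summits.QuantumFields.YangMills.Theorems.UnitScaleTiltProp7Lane2CutoffCommutators
import Summits.QuantumFields.YangMills.Theorems.UnitScaleTiltProp7BlockBumpExtension
import Summits.QuantumFields.YangMills.Theorems.UnitScaleTiltProp7TopMeanAdjointBlockLocal
import HarnessLib

/-!
# Route `UnitScaleTilt`, crux «MinimiserStabilityRegPr» (stmt-QuantumFields-19200, stub EX), positivity block, the LOD ∕ Combes–Thomas line (★p1 g24 `LOCATE-P349-CT` v2 §7 (E2);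
# ★★OWNER RULINGS №33∕№34∕№35, chair 22:12:46Z «px5 g11 ← (L3′a) MEMBER FILE») — **(L3′a) FILE A «LETTERS»: the member rows the weighted-L² ∕ H¹ Agmon estimate for
# `G_a = (Δ_U + aQ″†Q″)⁻¹` consumes** — (i) the top nested covariant mean has `(5∕4)η³`-bounded, block-supported coefficients; (ii) it commutes with block-constant
# multipliers and its block-constant lift `ι∘Q″` is bounded by `√(25κ∕8)`, `κ = c₁η³∕c₀`; (iii) real site multipliers are symmetric in the weighted `L²`; (iv) the
# covariant gradient conjugated by a positive weight `w` has the RELATIVE defect `η⁻¹(w(b₊)∕w(b₋) − 1)·Ad(U₀(b))λ(b₊)`, of norm `≤ √3·η⁻¹ρ·‖λ‖` when `|w₊∕w₋ − 1| ≤ ρ`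
# (ym3-torus-px5 g11, `LOCATE-L3a-px5g11.md`; FILE B `…Prop7MassivePropagatorAgmon` applies the namer's ✓`Prop7CorrectorAgmonDecay.agmon_corrector_bound` at `Pt := id`).

Cell `ym3-torus` (HUMAN RULING D-0037: YM₃ on T³ is ladder rung R3 — NOT d = 4, NOT infinite volume, NOT a mass gap, NOT Clay).  Width seat `ym3-torus-px5` (gen 11; WIDTH COPY of
ym3-torus-p1).  THEOREMS ONLY (0 `def`, 0 `sorry`); `--supports stmt-QuantumFields-19200 --as helper`, count-neutral.  HONEST LABEL (№35 (6)): «(L3′a) = [Balaban1985BackgroundPropagators]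
(3.46)-class weighted-L² Agmon row by a Combes–Thomas ∕ Agmon argument at the T³ member; (3.42) pointwise (L3′b) NOT claimed; feeds `hGF`[Lift] via (L5′)∕(L4); does NOT feed `h349`[Lift] alone».

WHAT IS PROVED (sorry-free, no definition; ns `…Theorems.Prop7MassivePropagatorAgmonLetters`; T³ member `F`, `n ≤ K`, weights `c₀, c₁ > 0`; `Q''` ANY linear map with clauses (iii)+(iv) of
✓`exists_intertwiner_of_regPr` — the `hseq` of ✓p746531 ∕ ✓p747168 ∕ ✓p747976 VERBATIM).
* §1 ★★`norm_nsTop_le_of_regPr` ∕ ★★`norm_topMean_le` — at `RegPr F n K ε₀ U₀`, `10⁷L³ε₀ ≤ 1`: `‖(Q''(toL2S λ)) y‖ ≤ (5∕4)·((L^d)^{K−n})⁻¹·Σ_{x∈B^{K−n}(y)}‖λ x‖`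
  (✓`norm_ns_sub_refMean_le_of_lt` + ROW-T, defect `2Ση_j ≤ 4500L²ε₀ ≤ ¼`, `Ad_C` isometric); ★`norm_topMean_single_le` (spike reading: entries `≤ (5∕4)η³`, block-supported).
* §2 ★`topMean_blockConst_smul` (`Q''(toL2S((g∘B^{K−n})·λ)) y = g y · Q''(toL2S λ) y`, real block-constant `g`; ✓p747168 `topMean_apply_eq_of_eqOn_iterBlock`);
  ★★`normSq_lift_topMean_le` (`‖toL2S F n c₁ ((Q''(toL2S λ)) ∘ siteShift)‖² ≤ (25∕8)·(c₁((L^d)^{K−n})⁻¹∕c₀)·‖toL2S λ‖²` — the block-constant lift of the top mean is a BOUNDED map,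
  K-uniformly at the isometric weight `c₁ = c₀η⁻³`).
* §3 `inner_toL2S_smul_left` (`⟪toL2S(w·λ), toL2S λ′⟫ = ⟪toL2S λ, toL2S(w·λ′)⟫`, real `w`), `inner_toL2_smul_left` (bonds), `inner_toL2S_smul_smul_inv` ∕ `inner_toL2_smul_smul_inv`
  (`⟪w·a, w⁻¹·b⟫ = ⟪a, b⟫`, `w > 0`), `norm_toL2S_smul_le` (`‖toL2S(w·λ)‖ ≤ ρ‖toL2S λ‖` when `|w| ≤ ρ`).
* §4 ★★`DL2_smul_eq_smul_add_defect` (`D_{U₀}(w·λ)(b) = w(b₋)·(D_{U₀}λ(b) + η⁻¹(w(b₊)∕w(b₋) − 1)·Ad(U₀(b))λ(b₊))`, `w(b₋) ≠ 0`; ✓`Prop7Lane2CutoffCommutators.DL2_smul_sub_smul_apply`),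
  ★★`normSq_gradDefect_le` (`‖toL2(b ↦ η⁻¹(w(b₊)∕w(b₋) − 1)·Ad(U₀(b))λ(b₊))‖² ≤ 3η⁻²ρ²·‖toL2S λ‖²` under `|w(b₊)∕w(b₋) − 1| ≤ ρ`).
HONEST SCOPE.  Letters; no inverse, no decay here; nothing of (L3′a)'s export, (L5′), (3.46), (3.49), `h349`, `hGF`, EX or the crux is proved; nothing continuum ∕ OS ∕ mass-gap ∕ Clay.

References: T. Bałaban, CMP **99** (1985) 389–434 [Balaban1985BackgroundPropagators] (Thm 3.1 (3.46) p.398, (3.3) p.391, (3.11) p.392, (3.19) p.393, (3.24) p.394, Thm 3.11 p.416);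
CMP **98** (1985) 17–51 [Balaban1985Averaging] ((97) p.32, (82) p.30); CMP **95** (1984) 17–40 [Balaban1984PropagatorsI] ((1.18) p.20); S. Agmon, *Lectures on exponential decay*
(Princeton 1982) Ch. 1 [Agmon1982].
-/

set_option autoImplicit false

noncomputable section

open scoped BigOperators Matrix.Norms.L2Operator InnerProductSpace ComplexConjugate

namespace Summit.QuantumFields.YangMills.Theorems.Prop7MassivePropagatorAgmonLetters

open Literature.MathematicalPhysics.QuantumFieldTheory.Balaban1983to89
open Finset
open T4Continuum BlockAveraging
open BlockAveraging (Idx)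
open B7Prop1Explicit (U1 mem_U1 treeWord disp)
open B7Eq78Linearization (conjR conjR_apply conjR_sub conjR_smul_real)
open B8Ineq132 (norm_conjR conjR_conjR one_conjR conjR_sum)
open B5Eq118OneStroke (iterBlockOf iterBlock mem_iterBlock iterBlock_zero sum_iterBlock_succ)
open B15DeterminingSets (embIter)
open B10Eq27TorusAxialLog (holT axialT transl unitsField toUField)
open B7TransferAnalyticMean (meanCLM)
open B9Eq311L2Pairing (WL2)
open B11Eq103H1Complex (SiteL2K)
open Summit.QuantumFields.YangMills.Theorems.Prop8Chart (emlIterU)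
open Summit.QuantumFields.YangMills.Theorems.Prop7NestedMeanPoincare (hstep_of_hsucc norm_ns_sub_refMean_le_of_lt)
open Literature.MathematicalPhysics.QuantumFieldTheory.Balaban1983to89.T3ContinuumYM3Torus
open T3SectALandauChart (eta eta_pos bgUnits)
open T3PrintedRegularMinimiser (RegPr)
open Summit.QuantumFields.YangMills.Theorems.Prop7SectET3Transport (periodsT3)
open Summit.QuantumFields.YangMills.Theorems.Prop7SectET3HilbertLetters (W₂ toL2S DL2)
open Summit.QuantumFields.YangMills.Theorems.Prop7SymAvgTwSym (holT_mem_U1 emlIterU_bgUnits_mem_U1_of_regPr)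
open Summit.QuantumFields.YangMills.Theorems.Prop7NestedMeanTowerCloseness (ref_T3_mem_U1 ref_T3_zero_self hclose_T3 two_mul_sum_eta_le_T3)
open Summit.QuantumFields.YangMills.Theorems.Prop7SectET3HilbertLetters (toL2)
open Summit.QuantumFields.YangMills.Theorems.Prop7SectET3RealCoordSums (inner_toL2S)
open Summit.QuantumFields.YangMills.Theorems.Prop7SectET3HilbertLetters (inner_toL2)
open Summit.QuantumFields.YangMills.Theorems.Prop7LaplaceAFlatLetters (norm_sq_toL2 norm_sq_toL2S)
open Summit.QuantumFields.YangMills.Theorems.Prop7TopMeanBlockLocal (topMean_apply_eq_of_eqOn_iterBlock)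
open Summit.QuantumFields.YangMills.Theorems.Prop7BlockBumpExtension (normSq_toL2S_comp_siteShift_eq sum_eq_sum_iterBlock)
open Summit.QuantumFields.YangMills.Theorems.Prop7Lane2CutoffCommutators (DL2_smul_sub_smul_apply sum_pbond_tgt)
open Summit.QuantumFields.YangMills.Theorems.Prop7CovariantCoercivity (sum_norm_sq_le_mul_opNorm_sq sum_norm_sq_R)
open T3PrintedRegularOrbits (sites_eq)
open T3LevelShift (siteShift)
open B9Eq39Adjoint (R)

variable (F : T3Family) {n K : ℕ}

/-- ★★ **THE NESTED-MEAN COEFFICIENT BOUND** (every averaging sequence, no kernel condition): at `RegPr F n K ε₀ U₀`, `10⁷L³ε₀ ≤ 1`, for the averaging sequence `ns` of `l`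
against the background tower (the `h0`∕`hsucc` recursion VERBATIM) and every top block `y`:
`‖ns (K − n) y‖ ≤ (5∕4)·((L^d)^{K−n})⁻¹·Σ_{x ∈ B^{K−n}(y)} ‖l x‖` — the top nested covariant mean is an AVERAGE of unitary conjugates up to the tower-closeness defect
`δ = 2Σ_{j<K−n}η_j ≤ 4500L²ε₀ ≤ ¼` (✓`norm_ns_sub_refMean_le_of_lt` with ROW-T's corner-axial references + the triangle inequality; `Ad_C` isometric).  Consequence for (L3′a):
the matrix entries of `a·Q″†Q″` in site⊗fibre coordinates are `≤ a·κ′·η³`-class and block-supported (✓p747466), so their cosh-budget is `O(a(cosh 3μ − 1))`, K-uniform.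
[cite: Balaban1985Averaging, (97) p.32, (82) p.30; Balaban1985BackgroundPropagators, (3.19) p.393, (3.24) p.394; Balaban1984PropagatorsI, (1.18) p.20] -/
theorem norm_nsTop_le_of_regPr {ε₀ : ℝ} (hε₀ : 0 < ε₀) (hε7 : 10 ^ 7 * (F.L : ℝ) ^ 3 * ε₀ ≤ 1)
    (U₀ : GaugeField (F.P K) 0 (Matrix.specialUnitaryGroup (Fin 2) ℂ)) (hreg : RegPr F n K ε₀ U₀)
    (ns : (j : ℕ) → Site (F.P K) j → Matrix (Fin 2) (Fin 2) ℂ) (l : Site (F.P K) 0 → Matrix (Fin 2) (Fin 2) ℂ) (h0 : ns 0 = l)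
    (hsucc : ∀ (j : ℕ) (y : Site (F.P K) (j + 1)), ns (j + 1) y = ns j (emb y) - meanCLM (Idx (F.P K)) (Matrix (Fin 2) (Fin 2) ℂ) fun i : Idx (F.P K) =>
        ns j (emb y) - ((holT (emlIterU j (bgUnits F K U₀)) (emb y) (stairWord i.2.1 (off i.1)) : (Matrix (Fin 2) (Fin 2) ℂ)ˣ) : Matrix (Fin 2) (Fin 2) ℂ) *
          ns j (transl (emb y) (disp (stairWord i.2.1 (off i.1)))) * (((holT (emlIterU j (bgUnits F K U₀)) (emb y) (stairWord i.2.1 (off i.1)))⁻¹ : (Matrix (Fin 2) (Fin 2) ℂ)ˣ) : Matrix (Fin 2) (Fin 2) ℂ))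
    (y : Site (F.P K) (K - n)) :
    ‖ns (K - n) y‖ ≤ (5 / 4) * (((((F.P K).L : ℝ) ^ (F.P K).d) ^ (K - n))⁻¹ * ∑ x ∈ iterBlock (K - n) y, ‖l x‖) := by
  have hk₀ : K - n ≤ (F.P K).m + (F.P K).K := by
    show K - n ≤ F.m + K; have := F.hm; omega
  have hL3 : 3 ≤ F.L := by obtain ⟨a, ha⟩ := F.hL.1; have := F.hL.2; omega
  have hL3r : (3 : ℝ) ≤ F.L := by exact_mod_cast hL3
  -- ROW-T closeness (before naming the transports, so that `set` rewrites it)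
  have hclose := hclose_T3 F hε₀ hε7 U₀ hreg.plaqSmall
  set T : (j : ℕ) → Site (F.P K) (j + 1) → Idx (F.P K) → (Matrix (Fin 2) (Fin 2) ℂ)ˣ :=
    fun j y i => holT (emlIterU j (bgUnits F K U₀)) (emb y) (stairWord i.2.1 (off i.1)) with hTdef
  have hT : ∀ j, j < K - n → ∀ (y : Site (F.P K) (j + 1)) (i : Idx (F.P K)), T j y i ∈ U1 (Matrix (Fin 2) (Fin 2) ℂ) :=
    fun j hj y i => holT_mem_U1 (fun b => emlIterU_bgUnits_mem_U1_of_regPr F hε₀ hε7 hreg hj.le b) _ _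
  have hstep : ∀ j, j < K - n → ∀ (y : Site (F.P K) (j + 1)),
      ns (j + 1) y = ((Fintype.card (Idx (F.P K)) : ℝ)⁻¹) • ∑ i : Idx (F.P K), conjR (T j y i) (ns j (Site.blockSite y i.1)) :=
    fun j _ y => hstep_of_hsucc T ns hsucc j y
  set C : (j : ℕ) → Site (F.P K) j → Site (F.P K) 0 → (Matrix (Fin 2) (Fin 2) ℂ)ˣ :=
    fun j z x => (axialT (bgUnits F K U₀) (Site.fibreSite 0 (K - n) (iterBlockOf (K - n) x) fun _ => (⟨0, pow_pos (F.P K).L_pos (K - n)⟩ : Fin ((F.P K).L ^ (K - n))))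
        (embIter j z))⁻¹ *
      axialT (bgUnits F K U₀) (Site.fibreSite 0 (K - n) (iterBlockOf (K - n) x) fun _ => (⟨0, pow_pos (F.P K).L_pos (K - n)⟩ : Fin ((F.P K).L ^ (K - n)))) x with hCdef
  have hC : ∀ j, j ≤ K - n → ∀ (z : Site (F.P K) j) (x : Site (F.P K) 0), C j z x ∈ U1 (Matrix (Fin 2) (Fin 2) ℂ) := fun j _ z x => ref_T3_mem_U1 F U₀ j z x
  have hC0 : ∀ x : Site (F.P K) 0, C 0 x x = 1 := fun x => ref_T3_zero_self F U₀ x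
  set η : ℕ → ℝ := fun j => 4500 * (F.L : ℝ) ^ 2 * ε₀ * ((F.L : ℝ) ^ j * eta F n K) with hηdef
  have hmain := norm_ns_sub_refMean_le_of_lt hk₀ T hT ns l (fun x => by rw [h0]) hstep C hC hC0 η hclose (K - n) le_rfl y
  -- the defect `δ = 2Ση_j ≤ 4500L²ε₀ ≤ ¼`
  have hδ : 2 * ∑ j ∈ range (K - n), η j ≤ 1 / 4 := by
    have hS := two_mul_sum_eta_le_T3 F (n := n) (K := K) hε₀.le
    have hA : 4500 * (F.L : ℝ) ^ 2 * ε₀ ≤ 1 / 4 := by nlinarith [hε7]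
    exact hS.trans hA
  set c : ℝ := ((((F.P K).L : ℝ) ^ (F.P K).d) ^ (K - n))⁻¹ with hc
  have hc0 : 0 ≤ c := by rw [hc]; have := (F.P K).L_pos; positivity
  set Ml : ℝ := ∑ x ∈ iterBlock (K - n) y, ‖l x‖ with hMl
  have hMl0 : 0 ≤ Ml := Finset.sum_nonneg fun _ _ => norm_nonneg _
  -- `‖c • Σ Ad_C l‖ ≤ c·Ml` (isometry of `Ad_C`)
  have hS : ‖c • ∑ x ∈ iterBlock (K - n) y, conjR (C (K - n) y x) (l x)‖ ≤ c * Ml := by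
    rw [norm_smul, Real.norm_of_nonneg hc0, hMl]
    refine mul_le_mul_of_nonneg_left ((norm_sum_le _ _).trans (Finset.sum_le_sum fun x _ => ?_)) hc0
    rw [norm_conjR (hC (K - n) le_rfl y x)]
  calc ‖ns (K - n) y‖ ≤ ‖ns (K - n) y - c • ∑ x ∈ iterBlock (K - n) y, conjR (C (K - n) y x) (l x)‖ + ‖c • ∑ x ∈ iterBlock (K - n) y, conjR (C (K - n) y x) (l x)‖ :=
        norm_le_norm_sub_add _ _
    _ ≤ (2 * ∑ j ∈ range (K - n), η j) * (c * Ml) + c * Ml := add_le_add hmain hS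
    _ ≤ (1 / 4) * (c * Ml) + c * Ml := by nlinarith [hδ, mul_nonneg hc0 hMl0]
    _ = (5 / 4) * (c * Ml) := by ring

/-- ★★ **THE SAME FOR ANY `Q″` OF RECORD** (clauses (iii)+(iv) of ✓`exists_intertwiner_of_regPr`, the `hseq` of ✓p746531 VERBATIM): for every `λ` and every top block `y`,
`‖(Q''(toL2S λ)) y‖ ≤ (5∕4)·((L^d)^{K−n})⁻¹·Σ_{x ∈ B^{K−n}(y)} ‖λ x‖` — so `Q″` has operator-norm-`(5∕4)η³` coefficients supported on the block (`η³ = (L³)^{−(K−n)}`).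
[cite: Balaban1985Averaging, (97) p.32; Balaban1985BackgroundPropagators, (3.19) p.393, (3.24) p.394] -/
theorem norm_topMean_le {c₀ : ℝ} [Fact (0 < c₀)] {ε₀ : ℝ} (hε₀ : 0 < ε₀) (hε7 : 10 ^ 7 * (F.L : ℝ) ^ 3 * ε₀ ≤ 1)
    (U₀ : GaugeField (F.P K) 0 (Matrix.specialUnitaryGroup (Fin 2) ℂ)) (hreg : RegPr F n K ε₀ U₀)
    (Q'' : SiteL2K ℂ 3 (periodsT3 F K) c₀ W₂ →ₗ[ℂ] (Site (F.P K) (K - n) → Matrix (Fin 2) (Fin 2) ℂ))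
    (hseq : ∀ lam : Site (F.P K) 0 → Matrix (Fin 2) (Fin 2) ℂ, ∃ ns : (j : ℕ) → Site (F.P K) j → Matrix (Fin 2) (Fin 2) ℂ, ns 0 = lam ∧
        (∀ (j : ℕ) (y : Site (F.P K) (j + 1)), ns (j + 1) y = ns j (emb y) - meanCLM (Idx (F.P K)) (Matrix (Fin 2) (Fin 2) ℂ) fun i : Idx (F.P K) =>
          ns j (emb y) - ((holT (emlIterU j (bgUnits F K U₀)) (emb y) (stairWord i.2.1 (off i.1)) : (Matrix (Fin 2) (Fin 2) ℂ)ˣ) : Matrix (Fin 2) (Fin 2) ℂ) *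
            ns j (transl (emb y) (disp (stairWord i.2.1 (off i.1)))) * (((holT (emlIterU j (bgUnits F K U₀)) (emb y) (stairWord i.2.1 (off i.1)))⁻¹ : (Matrix (Fin 2) (Fin 2) ℂ)ˣ) : Matrix (Fin 2) (Fin 2) ℂ)) ∧
        ns (K - n) = Q'' (toL2S F K c₀ lam))
    (lam : Site (F.P K) 0 → Matrix (Fin 2) (Fin 2) ℂ) (y : Site (F.P K) (K - n)) :
    ‖Q'' (toL2S F K c₀ lam) y‖ ≤ (5 / 4) * (((((F.P K).L : ℝ) ^ (F.P K).d) ^ (K - n))⁻¹ * ∑ x ∈ iterBlock (K - n) y, ‖lam x‖) := by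
  obtain ⟨ns, h0, hsucc, htop⟩ := hseq lam
  have h := norm_nsTop_le_of_regPr F hε₀ hε7 U₀ hreg ns lam h0 hsucc y
  rw [htop] at h
  exact h

/-- ★ **SPIKE READING**: for a spike `λ = Pi.single x X`, `‖(Q''(toL2S (Pi.single x X))) y‖ ≤ (5∕4)·((L^d)^{K−n})⁻¹·‖X‖` if `x ∈ B^{K−n}(y)` and `= 0`-bounded (`≤ 0`) otherwise —
the matrix of `Q″` in site⊗fibre coordinates has block-supported columns with entries `≤ (5∕4)η³`. [cite: Balaban1985Averaging, (97) p.32; Balaban1985BackgroundPropagators, (3.24) p.394] -/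
theorem norm_topMean_single_le {c₀ : ℝ} [Fact (0 < c₀)] {ε₀ : ℝ} (hε₀ : 0 < ε₀) (hε7 : 10 ^ 7 * (F.L : ℝ) ^ 3 * ε₀ ≤ 1)
    (U₀ : GaugeField (F.P K) 0 (Matrix.specialUnitaryGroup (Fin 2) ℂ)) (hreg : RegPr F n K ε₀ U₀)
    (Q'' : SiteL2K ℂ 3 (periodsT3 F K) c₀ W₂ →ₗ[ℂ] (Site (F.P K) (K - n) → Matrix (Fin 2) (Fin 2) ℂ))
    (hseq : ∀ lam : Site (F.P K) 0 → Matrix (Fin 2) (Fin 2) ℂ, ∃ ns : (j : ℕ) → Site (F.P K) j → Matrix (Fin 2) (Fin 2) ℂ, ns 0 = lam ∧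
        (∀ (j : ℕ) (y : Site (F.P K) (j + 1)), ns (j + 1) y = ns j (emb y) - meanCLM (Idx (F.P K)) (Matrix (Fin 2) (Fin 2) ℂ) fun i : Idx (F.P K) =>
          ns j (emb y) - ((holT (emlIterU j (bgUnits F K U₀)) (emb y) (stairWord i.2.1 (off i.1)) : (Matrix (Fin 2) (Fin 2) ℂ)ˣ) : Matrix (Fin 2) (Fin 2) ℂ) *
            ns j (transl (emb y) (disp (stairWord i.2.1 (off i.1)))) * (((holT (emlIterU j (bgUnits F K U₀)) (emb y) (stairWord i.2.1 (off i.1)))⁻¹ : (Matrix (Fin 2) (Fin 2) ℂ)ˣ) : Matrix (Fin 2) (Fin 2) ℂ)) ∧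
        ns (K - n) = Q'' (toL2S F K c₀ lam))
    [DecidableEq (Site (F.P K) 0)] (x : Site (F.P K) 0) (X : Matrix (Fin 2) (Fin 2) ℂ) (y : Site (F.P K) (K - n)) :
    ‖Q'' (toL2S F K c₀ (Pi.single x X)) y‖ ≤ (5 / 4) * (((((F.P K).L : ℝ) ^ (F.P K).d) ^ (K - n))⁻¹ * (if x ∈ iterBlock (K - n) y then ‖X‖ else 0)) := by
  have h := norm_topMean_le F hε₀ hε7 U₀ hreg Q'' hseq (Pi.single x X) y
  have hsum : ∑ x' ∈ iterBlock (K - n) y, ‖(Pi.single x X : Site (F.P K) 0 → Matrix (Fin 2) (Fin 2) ℂ) x'‖ = if x ∈ iterBlock (K - n) y then ‖X‖ else 0 := by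
    have hpt : ∀ x', ‖(Pi.single x X : Site (F.P K) 0 → Matrix (Fin 2) (Fin 2) ℂ) x'‖ = if x = x' then ‖X‖ else 0 := by
      intro x'
      by_cases hx : x = x'
      · subst hx; rw [Pi.single_eq_same, if_pos rfl]
      · rw [Pi.single_eq_of_ne' hx, norm_zero, if_neg hx]
    simp_rw [hpt]
    rw [Finset.sum_ite_eq]
  rw [hsum] at h
  exact h


/-! ## §2 The top mean commutes with block-constant multipliers; its block-constant lift is bounded -/

section Lift

variable {c₀ : ℝ} [Fact (0 < c₀)] (U₀ : GaugeField (F.P K) 0 (Matrix.specialUnitaryGroup (Fin 2) ℂ))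
  (Q'' : SiteL2K ℂ 3 (periodsT3 F K) c₀ W₂ →ₗ[ℂ] (Site (F.P K) (K - n) → Matrix (Fin 2) (Fin 2) ℂ))
  (hseq : ∀ lam : Site (F.P K) 0 → Matrix (Fin 2) (Fin 2) ℂ, ∃ ns : (j : ℕ) → Site (F.P K) j → Matrix (Fin 2) (Fin 2) ℂ, ns 0 = lam ∧
      (∀ (j : ℕ) (y : Site (F.P K) (j + 1)), ns (j + 1) y = ns j (emb y) - meanCLM (Idx (F.P K)) (Matrix (Fin 2) (Fin 2) ℂ) fun i : Idx (F.P K) =>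
        ns j (emb y) - ((holT (emlIterU j (bgUnits F K U₀)) (emb y) (stairWord i.2.1 (off i.1)) : (Matrix (Fin 2) (Fin 2) ℂ)ˣ) : Matrix (Fin 2) (Fin 2) ℂ) *
          ns j (transl (emb y) (disp (stairWord i.2.1 (off i.1)))) * (((holT (emlIterU j (bgUnits F K U₀)) (emb y) (stairWord i.2.1 (off i.1)))⁻¹ : (Matrix (Fin 2) (Fin 2) ℂ)ˣ) : Matrix (Fin 2) (Fin 2) ℂ)) ∧
      ns (K - n) = Q'' (toL2S F K c₀ lam))

omit [Fact (0 < c₀)] in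
include hseq in
/-- ★ **THE TOP MEAN COMMUTES WITH BLOCK-CONSTANT MULTIPLIERS**: for a real `g` on the coarse sites, `Q''(toL2S((g∘B^{K−n})·λ)) y = g y · Q''(toL2S λ) y` — on the block `B(y)` the
field `(g∘B)·λ` agrees with the constant multiple `g(y)·λ` (✓`topMean_apply_eq_of_eqOn_iterBlock`, linearity).  So the `Q″`-summand of the conjugated operator carries NO
defect for block-constant weights, and for a fine-Lipschitz weight only the in-block oscillation. [cite: Balaban1985BackgroundPropagators, (3.19) p.393; Balaban1984PropagatorsI, (1.18) p.20] -/
theorem topMean_blockConst_smul (g : Site (F.P K) (K - n) → ℝ) (lam : Site (F.P K) 0 → Matrix (Fin 2) (Fin 2) ℂ) (y : Site (F.P K) (K - n)) :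
    Q'' (toL2S F K c₀ fun x => g (iterBlockOf (K - n) x) • lam x) y = g y • Q'' (toL2S F K c₀ lam) y := by
  have h := topMean_apply_eq_of_eqOn_iterBlock F U₀ Q'' hseq (fun x => g (iterBlockOf (K - n) x) • lam x) (fun x => g y • lam x) y
    (fun x hx => by simp only [hx])
  rw [h]
  have hlin : (toL2S F K c₀ fun x => g y • lam x) = ((g y : ℝ) : ℂ) • toL2S F K c₀ lam := by
    rw [← map_smul]
    congr 1
  rw [hlin, map_smul, Pi.smul_apply, Complex.coe_smul]

include hseq in
/-- ★★ **THE BLOCK-CONSTANT LIFT OF THE TOP MEAN IS BOUNDED, K-UNIFORMLY**: at `RegPr F n K ε₀ U₀`, `10⁷L³ε₀ ≤ 1`,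
`‖toL2S F n c₁ ((Q''(toL2S λ)) ∘ siteShift)‖² ≤ (25∕8)·(c₁·((L^d)^{K−n})⁻¹∕c₀)·‖toL2S λ‖²` (§1 + Cauchy–Schwarz on each block, `#B^{K−n}(y) = (L^d)^{K−n}`, Frobenius `≤ 2·`op² on `M₂`,
op² `≤` Frobenius; at the isometric coarse weight `c₁ = c₀(L^d)^{K−n}` the constant is `25∕8`). [cite: Balaban1985BackgroundPropagators, (3.16) p.393, (3.24) p.394; Balaban1985Averaging, (97) p.32] -/
theorem normSq_lift_topMean_le (h : n ≤ K) {c₁ : ℝ} [Fact (0 < c₁)] {ε₀ : ℝ} (hε₀ : 0 < ε₀) (hε7 : 10 ^ 7 * (F.L : ℝ) ^ 3 * ε₀ ≤ 1) (hreg : RegPr F n K ε₀ U₀)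
    (lam : Site (F.P K) 0 → Matrix (Fin 2) (Fin 2) ℂ) :
    ‖toL2S F n c₁ (fun z => Q'' (toL2S F K c₀ lam) (siteShift (sites_eq F n K h) z))‖ ^ 2
      ≤ (25 / 8) * (c₁ * ((((F.P K).L : ℝ) ^ (F.P K).d) ^ (K - n))⁻¹ / c₀) * ‖toL2S F K c₀ lam‖ ^ 2 := by
  have hc₀ : 0 < c₀ := Fact.out
  have hc₁ : 0 < c₁ := Fact.out
  have hk : K - n ≤ (F.P K).m + (F.P K).K := by show K - n ≤ F.m + K; have := F.hm; omega
  set c : ℝ := ((((F.P K).L : ℝ) ^ (F.P K).d) ^ (K - n))⁻¹ with hc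
  have hLd : (0 : ℝ) < (((F.P K).L : ℝ) ^ (F.P K).d) ^ (K - n) := by have := (F.P K).L_pos; positivity
  have hc0 : 0 < c := by rw [hc]; positivity
  have hcard : ∀ y : Site (F.P K) (K - n), ((iterBlock (K - n) y).card : ℝ) = c⁻¹ := fun y => by
    rw [B5Eq118OneStroke.card_iterBlock (K - n) hk y, hc, inv_inv]; push_cast; ring
  rw [normSq_toL2S_comp_siteShift_eq F h, norm_sq_toL2S]
  -- per block: `Σ_jk |(Q″λ)_y jk|² ≤ 2‖(Q″λ) y‖² ≤ 2·(25/16)c²(Σ_B‖λ‖)² ≤ (25/8)c²·c⁻¹·Σ_B‖λ x‖²`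
  have hblock : ∀ y : Site (F.P K) (K - n), ∑ j : Fin 2, ∑ k : Fin 2, ‖Q'' (toL2S F K c₀ lam) y j k‖ ^ 2
      ≤ (25 / 8) * c * ∑ x ∈ iterBlock (K - n) y, ‖lam x‖ ^ 2 := by
    intro y
    have h1 : ∑ j : Fin 2, ∑ k : Fin 2, ‖Q'' (toL2S F K c₀ lam) y j k‖ ^ 2 ≤ 2 * ‖Q'' (toL2S F K c₀ lam) y‖ ^ 2 := by
      have := sum_norm_sq_le_mul_opNorm_sq (N := 2) (Q'' (toL2S F K c₀ lam) y)
      simpa using this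
    have h2 := norm_topMean_le F hε₀ hε7 U₀ hreg Q'' hseq lam y
    have hM0 : 0 ≤ ∑ x ∈ iterBlock (K - n) y, ‖lam x‖ := Finset.sum_nonneg fun _ _ => norm_nonneg _
    have h3 : ‖Q'' (toL2S F K c₀ lam) y‖ ^ 2 ≤ ((5 / 4) * (c * ∑ x ∈ iterBlock (K - n) y, ‖lam x‖)) ^ 2 :=
      pow_le_pow_left₀ (norm_nonneg _) h2 2
    have h4 : (∑ x ∈ iterBlock (K - n) y, ‖lam x‖) ^ 2 ≤ (iterBlock (K - n) y).card * ∑ x ∈ iterBlock (K - n) y, ‖lam x‖ ^ 2 := by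
      have := sq_sum_le_card_mul_sum_sq (s := iterBlock (K - n) y) (f := fun x => ‖lam x‖)
      simpa using this
    rw [hcard y] at h4
    have h5 : ((5 / 4) * (c * ∑ x ∈ iterBlock (K - n) y, ‖lam x‖)) ^ 2 ≤ (25 / 16) * c * ∑ x ∈ iterBlock (K - n) y, ‖lam x‖ ^ 2 := by
      have e : ((5 / 4) * (c * ∑ x ∈ iterBlock (K - n) y, ‖lam x‖)) ^ 2 = (25 / 16) * c * (c * (∑ x ∈ iterBlock (K - n) y, ‖lam x‖) ^ 2) := by ring
      rw [e]
      refine mul_le_mul_of_nonneg_left ?_ (by positivity)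
      calc c * (∑ x ∈ iterBlock (K - n) y, ‖lam x‖) ^ 2 ≤ c * (c⁻¹ * ∑ x ∈ iterBlock (K - n) y, ‖lam x‖ ^ 2) := mul_le_mul_of_nonneg_left h4 hc0.le
        _ = ∑ x ∈ iterBlock (K - n) y, ‖lam x‖ ^ 2 := by rw [← mul_assoc, mul_inv_cancel₀ hc0.ne', one_mul]
    linarith
  -- sum over the blocks and compare with `‖toL2S λ‖² = c₀ΣΣ|λ|²`
  have hsum : ∑ Y : Site (F.P K) (K - n), ∑ j : Fin 2, ∑ k : Fin 2, ‖Q'' (toL2S F K c₀ lam) Y j k‖ ^ 2 ≤ (25 / 8) * c * ∑ x : Site (F.P K) 0, ‖lam x‖ ^ 2 := by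
    rw [sum_eq_sum_iterBlock (k := K - n) (fun x => ‖lam x‖ ^ 2), Finset.mul_sum]
    exact Finset.sum_le_sum fun y _ => hblock y
  have hop : ∑ x : Site (F.P K) 0, ‖lam x‖ ^ 2 ≤ ∑ x : Site (F.P K) 0, ∑ j : Fin 2, ∑ k : Fin 2, ‖lam x j k‖ ^ 2 :=
    Finset.sum_le_sum fun x _ => MatrixNorms.opNorm_sq_le_sum_norm_sq (lam x)
  have hS0 : 0 ≤ ∑ x : Site (F.P K) 0, ∑ j : Fin 2, ∑ k : Fin 2, ‖lam x j k‖ ^ 2 :=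
    Finset.sum_nonneg fun _ _ => Finset.sum_nonneg fun _ _ => Finset.sum_nonneg fun _ _ => sq_nonneg _
  calc c₁ * ∑ Y : Site (F.P K) (K - n), ∑ j : Fin 2, ∑ k : Fin 2, ‖Q'' (toL2S F K c₀ lam) Y j k‖ ^ 2
      ≤ c₁ * ((25 / 8) * c * ∑ x : Site (F.P K) 0, ∑ j : Fin 2, ∑ k : Fin 2, ‖lam x j k‖ ^ 2) :=
        mul_le_mul_of_nonneg_left (hsum.trans (mul_le_mul_of_nonneg_left hop (by positivity))) hc₁.le
    _ = (25 / 8) * (c₁ * c / c₀) * (c₀ * ∑ x : Site (F.P K) 0, ∑ j : Fin 2, ∑ k : Fin 2, ‖lam x j k‖ ^ 2) := by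
        field_simp
    _ = _ := by rfl

end Lift

/-! ## §3 Real site ∕ bond multipliers are symmetric in the weighted `L²`; reciprocal weights pair to the identity -/

section Multipliers

variable {c₀ : ℝ} [Fact (0 < c₀)]

/-- **REAL SITE MULTIPLIERS ARE SYMMETRIC**: `⟪toL2S(w·λ), toL2S λ′⟫ = ⟪toL2S λ, toL2S(w·λ′)⟫` (✓`inner_toL2S`; `(w·X)ᴴ = w·Xᴴ` for real `w`).
[cite: Balaban1985BackgroundPropagators, (3.11) p.392] -/
theorem inner_toL2S_smul_left (w : Site (F.P K) 0 → ℝ) (lam lam' : Site (F.P K) 0 → Matrix (Fin 2) (Fin 2) ℂ) :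
    ⟪toL2S F K c₀ (fun x => w x • lam x), toL2S F K c₀ lam'⟫_ℂ = ⟪toL2S F K c₀ lam, toL2S F K c₀ (fun x => w x • lam' x)⟫_ℂ := by
  rw [inner_toL2S, inner_toL2S]
  congr 1
  refine Finset.sum_congr rfl fun x _ => ?_
  rw [← Complex.coe_smul, ← Complex.coe_smul, Matrix.conjTranspose_smul, Matrix.smul_mul, Matrix.mul_smul, Complex.star_def, Complex.conj_ofReal]

/-- **REAL BOND MULTIPLIERS ARE SYMMETRIC**: `⟪toL2(w·A), toL2 B⟫ = ⟪toL2 A, toL2(w·B)⟫`. [cite: Balaban1985BackgroundPropagators, (3.11) p.392] -/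
theorem inner_toL2_smul_left (w : PBond (F.P K) 0 → ℝ) (A B : PBond (F.P K) 0 → Matrix (Fin 2) (Fin 2) ℂ) :
    ⟪toL2 F K c₀ (fun b => w b • A b), toL2 F K c₀ B⟫_ℂ = ⟪toL2 F K c₀ A, toL2 F K c₀ (fun b => w b • B b)⟫_ℂ := by
  rw [inner_toL2, inner_toL2]
  congr 1
  refine Finset.sum_congr rfl fun b _ => ?_
  rw [← Complex.coe_smul, ← Complex.coe_smul, Matrix.conjTranspose_smul, Matrix.smul_mul, Matrix.mul_smul, Complex.star_def, Complex.conj_ofReal]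

/-- **RECIPROCAL SITE WEIGHTS PAIR TO THE IDENTITY**: `⟪toL2S(w·λ), toL2S(w⁻¹·λ′)⟫ = ⟪toL2S λ, toL2S λ′⟫` for `w ≠ 0` pointwise (the `hpair` row of ✓`agmon_corrector_bound` on sites).
[cite: Balaban1985BackgroundPropagators, (3.11) p.392] -/
theorem inner_toL2S_smul_smul_inv (w : Site (F.P K) 0 → ℝ) (hw : ∀ x, w x ≠ 0) (lam lam' : Site (F.P K) 0 → Matrix (Fin 2) (Fin 2) ℂ) :
    ⟪toL2S F K c₀ (fun x => w x • lam x), toL2S F K c₀ (fun x => (w x)⁻¹ • lam' x)⟫_ℂ = ⟪toL2S F K c₀ lam, toL2S F K c₀ lam'⟫_ℂ := by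
  rw [inner_toL2S_smul_left]
  congr 2
  funext x
  rw [smul_smul, mul_inv_cancel₀ (hw x), one_smul]

/-- **RECIPROCAL BOND WEIGHTS PAIR TO THE IDENTITY**: `⟪toL2(w·A), toL2(w⁻¹·B)⟫ = ⟪toL2 A, toL2 B⟫` for `w ≠ 0` pointwise (the `hpair` row on bonds).
[cite: Balaban1985BackgroundPropagators, (3.11) p.392] -/
theorem inner_toL2_smul_smul_inv (w : PBond (F.P K) 0 → ℝ) (hw : ∀ b, w b ≠ 0) (A B : PBond (F.P K) 0 → Matrix (Fin 2) (Fin 2) ℂ) :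
    ⟪toL2 F K c₀ (fun b => w b • A b), toL2 F K c₀ (fun b => (w b)⁻¹ • B b)⟫_ℂ = ⟪toL2 F K c₀ A, toL2 F K c₀ B⟫_ℂ := by
  rw [inner_toL2_smul_left]
  congr 2
  funext b
  rw [smul_smul, mul_inv_cancel₀ (hw b), one_smul]

/-- **A BOUNDED MULTIPLIER IS BOUNDED**: `|w| ≤ ρ` pointwise ⟹ `‖toL2S(w·λ)‖ ≤ ρ·‖toL2S λ‖`. [cite: Balaban1985BackgroundPropagators, (3.11) p.392] -/
theorem norm_toL2S_smul_le (w : Site (F.P K) 0 → ℝ) {ρ : ℝ} (hρ : 0 ≤ ρ) (hw : ∀ x, |w x| ≤ ρ) (lam : Site (F.P K) 0 → Matrix (Fin 2) (Fin 2) ℂ) :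
    ‖toL2S F K c₀ (fun x => w x • lam x)‖ ≤ ρ * ‖toL2S F K c₀ lam‖ := by
  have hc : 0 < c₀ := Fact.out
  have hpt : ∀ (x : Site (F.P K) 0) (j k : Fin 2), ‖(w x • lam x) j k‖ ^ 2 ≤ ρ ^ 2 * ‖lam x j k‖ ^ 2 := by
    intro x j k
    rw [Matrix.smul_apply, norm_smul, mul_pow, Real.norm_eq_abs]
    exact mul_le_mul_of_nonneg_right (pow_le_pow_left₀ (abs_nonneg _) (hw x) 2) (sq_nonneg _)
  have h2 : ‖toL2S F K c₀ (fun x => w x • lam x)‖ ^ 2 ≤ (ρ * ‖toL2S F K c₀ lam‖) ^ 2 := by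
    rw [mul_pow, norm_sq_toL2S, norm_sq_toL2S]
    have hsum : ∑ x : Site (F.P K) 0, ∑ j : Fin 2, ∑ k : Fin 2, ‖(w x • lam x) j k‖ ^ 2 ≤ ∑ x : Site (F.P K) 0, ∑ j : Fin 2, ∑ k : Fin 2, ρ ^ 2 * ‖lam x j k‖ ^ 2 :=
      Finset.sum_le_sum fun x _ => Finset.sum_le_sum fun j _ => Finset.sum_le_sum fun k _ => hpt x j k
    have e : ∑ x : Site (F.P K) 0, ∑ j : Fin 2, ∑ k : Fin 2, ρ ^ 2 * ‖lam x j k‖ ^ 2 = ρ ^ 2 * ∑ x : Site (F.P K) 0, ∑ j : Fin 2, ∑ k : Fin 2, ‖lam x j k‖ ^ 2 := by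
      simp_rw [Finset.mul_sum]
    rw [e] at hsum
    calc c₀ * ∑ x : Site (F.P K) 0, ∑ j : Fin 2, ∑ k : Fin 2, ‖(w x • lam x) j k‖ ^ 2 ≤ c₀ * (ρ ^ 2 * ∑ x : Site (F.P K) 0, ∑ j : Fin 2, ∑ k : Fin 2, ‖lam x j k‖ ^ 2) :=
          mul_le_mul_of_nonneg_left hsum hc.le
      _ = ρ ^ 2 * (c₀ * ∑ x : Site (F.P K) 0, ∑ j : Fin 2, ∑ k : Fin 2, ‖lam x j k‖ ^ 2) := by ring
  exact (pow_le_pow_iff_left₀ (norm_nonneg _) (by positivity) two_ne_zero).1 h2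

end Multipliers

/-! ## §4 The covariant gradient conjugated by a positive weight: the relative defect and its norm -/

section GradDefect

variable {c₀ : ℝ} [Fact (0 < c₀)] (U₀ : GaugeField (F.P K) 0 (Matrix.specialUnitaryGroup (Fin 2) ℂ))

/-- ★★ **`D_{U₀}` CONJUGATED BY A POSITIVE WEIGHT**: `D_{U₀}(w·λ)(b) = w(b₋)·(D_{U₀}λ(b) + η⁻¹(w(b₊)∕w(b₋) − 1)·Ad(U₀(b))λ(b₊))` for `w(b₋) ≠ 0` — the Leibniz row
✓`DL2_smul_sub_smul_apply` with the defect written RELATIVE to the weight at the source (the `D∘M = M′∘(D + K₁)` shape of ✓`agmon_corrector_bound`, `M′ = w(b₋)` on bonds).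
[cite: Balaban1985BackgroundPropagators, (3.3) p.391, Thm 3.1 p.397] -/
theorem DL2_smul_eq_smul_add_defect (w : Site (F.P K) 0 → ℝ) (lam : Site (F.P K) 0 → Matrix (Fin 2) (Fin 2) ℂ) (b : PBond (F.P K) 0) (hw : w b.src ≠ 0) :
    (toL2 F K c₀).symm (DL2 F n K c₀ U₀ (toL2S F K c₀ (fun x => w x • lam x))) b
      = w b.src • ((toL2 F K c₀).symm (DL2 F n K c₀ U₀ (toL2S F K c₀ lam)) b + ((eta F n K)⁻¹ * (w b.tgt / w b.src - 1)) • R (bgUnits F K U₀ b) (lam b.tgt)) := by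
  have h := DL2_smul_sub_smul_apply F n K c₀ U₀ w lam b
  rw [sub_eq_iff_eq_add] at h
  rw [h, smul_add, smul_smul, add_comm]
  congr 2
  field_simp

/-- ★★ **THE NORM OF THE RELATIVE GRADIENT DEFECT**: `|w(b₊)∕w(b₋) − 1| ≤ ρ` for every bond ⟹ `‖toL2(b ↦ η⁻¹(w(b₊)∕w(b₋) − 1)·Ad(U₀(b))λ(b₊))‖² ≤ 3·η⁻²·ρ²·‖toL2S λ‖²`
(`Ad` Frobenius-isometric ✓`sum_norm_sq_R`; every site is the target of 3 bonds ✓`sum_pbond_tgt`).  With `w = e^{φ}`, `|φ(b₊) − φ(b₋)| ≤ θ`: `ρ = e^{θ} − 1`; at slope `θ = μη`,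
`η⁻¹ρ ≤ μ·e^{μη}` — K-uniform. [cite: Balaban1985BackgroundPropagators, (3.3) p.391, (3.11) p.392, Thm 3.1 (3.46) p.398] -/
theorem normSq_gradDefect_le (w : Site (F.P K) 0 → ℝ) {ρ : ℝ} (hw : ∀ b : PBond (F.P K) 0, |w b.tgt / w b.src - 1| ≤ ρ)
    (lam : Site (F.P K) 0 → Matrix (Fin 2) (Fin 2) ℂ) :
    ‖toL2 F K c₀ (fun b => ((eta F n K)⁻¹ * (w b.tgt / w b.src - 1)) • R (bgUnits F K U₀ b) (lam b.tgt))‖ ^ 2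
      ≤ 3 * ((eta F n K)⁻¹) ^ 2 * ρ ^ 2 * ‖toL2S F K c₀ lam‖ ^ 2 := by
  have hc : 0 < c₀ := Fact.out
  rw [norm_sq_toL2, norm_sq_toL2S]
  have hterm : ∀ b : PBond (F.P K) 0, ∑ i : Fin 2, ∑ i' : Fin 2, ‖(((eta F n K)⁻¹ * (w b.tgt / w b.src - 1)) • R (bgUnits F K U₀ b) (lam b.tgt)) i i'‖ ^ 2
      ≤ ((eta F n K)⁻¹) ^ 2 * ρ ^ 2 * ∑ i : Fin 2, ∑ i' : Fin 2, ‖lam b.tgt i i'‖ ^ 2 := by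
    intro b
    have hR : ∑ i : Fin 2, ∑ i' : Fin 2, ‖(R (bgUnits F K U₀ b) (lam b.tgt)) i i'‖ ^ 2 = ∑ i : Fin 2, ∑ i' : Fin 2, ‖lam b.tgt i i'‖ ^ 2 :=
      sum_norm_sq_R (Prop7Lane2CutoffCommutators.coe_bgUnits_mem_unitary' F K U₀ b) (lam b.tgt)
    have hsm : ∑ i : Fin 2, ∑ i' : Fin 2, ‖(((eta F n K)⁻¹ * (w b.tgt / w b.src - 1)) • R (bgUnits F K U₀ b) (lam b.tgt)) i i'‖ ^ 2
        = ((eta F n K)⁻¹ * (w b.tgt / w b.src - 1)) ^ 2 * ∑ i : Fin 2, ∑ i' : Fin 2, ‖(R (bgUnits F K U₀ b) (lam b.tgt)) i i'‖ ^ 2 := by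
      rw [Finset.mul_sum]
      refine Finset.sum_congr rfl fun i _ => ?_
      rw [Finset.mul_sum]
      refine Finset.sum_congr rfl fun i' _ => ?_
      rw [Matrix.smul_apply, norm_smul, mul_pow, Real.norm_eq_abs, sq_abs]
    rw [hsm, hR, mul_pow]
    refine mul_le_mul_of_nonneg_right (mul_le_mul_of_nonneg_left ?_ (sq_nonneg _)) (Finset.sum_nonneg fun _ _ => Finset.sum_nonneg fun _ _ => sq_nonneg _)
    rw [← sq_abs]; exact pow_le_pow_left₀ (abs_nonneg _) (hw b) 2
  have hsum := Finset.sum_le_sum fun b (_ : b ∈ (Finset.univ : Finset (PBond (F.P K) 0))) => hterm b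
  rw [← Finset.mul_sum, sum_pbond_tgt F K (fun _ x => ∑ i : Fin 2, ∑ i' : Fin 2, ‖lam x i i'‖ ^ 2), Finset.sum_const, Finset.card_univ, Fintype.card_fin,
    nsmul_eq_mul, Nat.cast_ofNat] at hsum
  calc c₀ * ∑ b : PBond (F.P K) 0, ∑ i : Fin 2, ∑ i' : Fin 2, ‖(((eta F n K)⁻¹ * (w b.tgt / w b.src - 1)) • R (bgUnits F K U₀ b) (lam b.tgt)) i i'‖ ^ 2
      ≤ c₀ * (((eta F n K)⁻¹) ^ 2 * ρ ^ 2 * (3 * ∑ x : Site (F.P K) 0, ∑ i : Fin 2, ∑ i' : Fin 2, ‖lam x i i'‖ ^ 2)) := mul_le_mul_of_nonneg_left hsum hc.le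
    _ = _ := by ring

end GradDefect

end Summit.QuantumFields.YangMills.Theorems.Prop7MassivePropagatorAgmonLetters

end
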